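import Literature.Geometry.Lorentzian.CoordConstraintAdjoint
import Literature.Geometry.Lorentzian.TameGenericity
import HarnessLib

/-!
# Parametric KID-free gluing of vacuum data across a far annulus (Chruściel–Delay 2003)

Topic `Literature/Geometry/Lorentzian`. ONE named fact (D-0014), stated over the tree's vocabulary of
initial data sets (`InitialDataSet`), jointly smooth one-parameter families of data
(`InitialDataSet.IsSmoothDataFamily`), asymptotically flat ends and their chart components
(`AFEnd`, `AFEnd.far`, `AFEnd.hCoeff`, `AFEnd.kCoeff`) and the coordinate rows of the formal adjoint
`DΦ*` of the linearised constraint map (`MetricCoord.adjHamG/adjHamK/adjMomGS/adjMomKS`,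
`CoordConstraintAdjoint.lean`, whose joint kernel on an open set is the space of Killing initial data
= KIDs there):

* `Literature.Geometry.Lorentzian.ChruscielDelay_parametricAnnulusGluing` — **implicit-function gluing,
  parametric in one real parameter, of a jointly smooth family of vacuum data `F c → D` to the base
  datum `D` itself across a chart annulus `{R₁ < ‖y‖ < R₂}` of an end which carries no non-trivial KID
  of `D`**: there are `ε > 0` and a jointly smooth family `G` of VACUUM data through `G 0 = D`, equal to
  `F c` off `e.far R₁` (inside radius `R₁` and off the end) whenever `‖c‖ < ε`, and equal to `D` on
  `e.far R₂` (beyond radius `R₂`) for every `c`.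

Sources and what is assembled (hypothesis by hypothesis) are in the docstring. This is the annular,
one-parameter companion of the accepted point-local fact
`Literature.Geometry.Lorentzian.ChruscielDelay_localConstraintDeformation`
(`LocalConstraintDeformation.lean`, same four sources, same "routine but not printed verbatim" assembly
status); it is the elliptic half ("parametric tail gluing") of shell-surgery arguments localising a
one-parameter exit family of an exceptional datum to a compact set.

Deliberately NOT here: gluing up to the finite-dimensional KID obstruction (Corvino–Schoen /
Chruściel–Delay 2003 Thm. 8.6 / Mao–Oh–Tao Thm. 1.3, see `GluingUpToLinearObstructions.lean`), the
obstruction-free small-data gluing with a charge gap (`ObstructionFreeGluing.lean`), `k`-parameter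
families, non-vacuum sources, and any claim about asymptotics (admissibility of the glued data is
bookkeeping over `AdmissibleDataLocality.lean`, done by the user).
-/

noncomputable section

namespace Literature.Geometry.Lorentzian

open scoped Manifold ContDiff Topology

/-- **Chruściel–Delay parametric KID-free annular gluing** (named fact, D-0014).

Printed sources. (1) P. T. Chruściel, E. Delay, Mém. SMF 94 (2003) = gr-qc/0301073: **Thm. 5.9** (on a
compact manifold with boundary `M̄`, weights `x²`, `e^{s/x}`: for `(K, g)` close to a vacuum `(K₀, g₀)`
in `x⁻²W^{k+3,∞}_{x²} × W^{k+4,∞}_{x²}` and every small source `(δJ, δρ)` in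
`H^{k+1}_{x²,e^{s/x}} × H^{k}_{x²,e^{s/x}}` there is a small solution
`(δK, δg) = e^{−2s/x} Φ² P*(Y, N)` of the constraint equations with that source, PROJECTED OFF the
kernel `𝒦₀` of `P*` on `M` — the KIDs of `(K₀, g₀)` on the interior; with `𝒦₀ = 0` the projection is
the identity), **Prop. 5.10** and **Cor. 5.11** (smooth data and smooth source ⇒ the solution lies in
`x²C^∞_{x²,e^{s/x}} × x⁴C^∞_{x²,e^{s/x}} ⊂ C^∞(M̄)` "and can be smoothly extended by zero across
`∂M`"), and **§8** after Thm. 8.6 (extensions "under smallness conditions": for `(K, g)` in a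
one-parameter family `(K_λ, g_λ)` of vacuum data converging to `(K₀|_M, g₀|_M)` as `λ → 0`,
"proceeding as above one obtains an extension for `λ` small enough when `P*` has no kernel on `𝒱`").
(2) P. T. Chruściel, E. Delay, J. Geom. Phys. 51 (2004) = gr-qc/0309001, **Thm. 6.6**, Cor. 5.11: with
these weights the KID-free vacuum data on `M̄` form an embedded `C^∞` Banach submanifold (the constraint
map is a submersion off KIDs; smooth dependence of the solution operator). (3) J. Corvino, R. Schoen,
J. Differential Geom. 73 (2006) = gr-qc/0301071, **Thm. 2**: local surjectivity of the vacuum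
constraint map on a compactly contained smooth domain `Ω` whose linearised constraint map has
injective formal adjoint (no KIDs on `Ω`), solutions equal to the background outside `Ω`, smooth for
smooth data. (4) P. T. Chruściel, J. Isenberg, D. Pollack, CMP 257 (2005) = gr-qc/0403066, §§2–4
(annular vacuum gluing for data without KIDs on the gluing annulus: cut-off interpolation plus
Corvino–Schoen/Chruściel–Delay correction supported in the closed annulus).

What is vendored (hypothesis by hypothesis). `X` a `3`-manifold, `e` an asymptotically flat end of
`X` with chart `e.U ≅ {‖y‖ > e.R}`; `D = (h, k)` a smooth datum on `X` solving the vacuum constraints;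
`F : ℝ¹ → data` a jointly smooth one-parameter family (`IsSmoothDataFamily 1 F`) of solutions of the
vacuum constraints with `F 0 = D`; radii `e.R ≤ R₁ < R₂`, so that the open chart annulus
`A = {R₁ < ‖y‖ < R₂}` lies in the end; and NO non-trivial KID of `D` on `A`: every pair `(N, Y)`,
smooth on `A`, solving there the Killing initial data equations — the kernel equations of the formal
adjoint `DΦ*` at the chart components `(e.hCoeff D, e.kCoeff D)` (Chruściel–Delay 2003 §2;
Moncrief 1975) — vanishes identically on `A` (stated as the negation of "there is such a pair not both
zero at some point of `A`"). CONCLUSION: there are `ε > 0` and a jointly smooth family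
`G : ℝ¹ → data` of solutions of the VACUUM constraints with `G 0 = D`, such that `G c` agrees with
`F c` at every point NOT in `e.far R₁` (i.e. off the end and at chart radius `≤ R₁`) whenever
`‖c‖ < ε`, and `G c` agrees with `D` at every point of `e.far R₂` (chart radius `> R₂`) for EVERY `c`.
Assembly of (1)–(4), each step routine but not printed verbatim: (i) fix `R₁ < R₁' < R₂' < R₂` and a
radial cut-off `χ = 1` on `‖y‖ ≤ R₁'`, `χ = 0` on `‖y‖ ≥ R₂'`; the interpolant
`I_c := χ F c + (1 − χ) D` on the end (and `:= F c` off the end) is a jointly smooth family through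
`I_0 = D`, fails the vacuum constraints only in `{R₁' ≤ ‖y‖ ≤ R₂'} ⋐ A`, and, on the COMPACT closed
annulus `Ā`, `I_c → D` in every `C^m(Ā)` as `c → 0` by joint smoothness alone, so the source
`(δJ, δρ)_c := −(J, ρ)(I_c)`, compactly supported in `A`, is small in every weighted space of (1);
(ii) the kernel `𝒦₀` of (1) for `(K₀, g₀) = D|_Ā` consists of smooth KIDs of `D` on the open annulus,
hence is trivial by hypothesis, so Thm. 5.9 of (1) solves the full (unprojected) equations: for `‖c‖`
small, `G_c := I_c + (δK, δg)_c` on `Ā` solves the vacuum constraints, with `(δK, δg)_c` smooth up to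
`∂A` and extended by zero (Cor. 5.11), so `G_c = F c` on `‖y‖ ≤ R₁` and off the end, `G_c = D` on
`‖y‖ ≥ R₂`, smooth and (for `c` small) Riemannian on `X`; at `c = 0` the source vanishes and the small
solution is `0`, so `G_0 = D`; (iii) the solution of (1) comes from the inverse function theorem on
Banach spaces with `C^∞` dependence on `(K, g, δJ, δρ)` ((2), Thm. 6.6), and `c ↦ (I_c|_Ā, source_c)`
is `C^∞` into each of these spaces, so `c ↦ (δK, δg)_c` is `C^∞` into every `C^m(Ā)` by the interior
and boundary regularity of (1), Prop. 5.10 / Cor. 5.11, whence `(c, x) ↦ G_c(x)` is jointly `C^∞` on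
`{‖c‖ < ε₀} × X`; (iv) a smooth squash `ψ : ℝ¹ → {‖c‖ < ε₀}` with `ψ c = c` for `‖c‖ < ε := ε₀/2`
makes `G := c ↦ G_{ψ c}` a family on all of `ℝ¹` keeping every clause. Nothing is claimed when `A`
carries a non-trivial KID (then gluing to the EXACT tail of `D` is obstructed by the KID charges), and
asymptotic flatness is neither assumed nor concluded (the glued data simply coincide with `D` beyond
radius `R₂`). [cite: ChruscielDelay2003, Thm. 5.9, Prop. 5.10, Cor. 5.11 and §8 (after Thm. 8.6)]
[cite: ChruscielDelay2004, Thm. 6.6 and Cor. 5.11] [cite: CorvinoSchoen2006, Thm. 2]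
[cite: ChruscielIsenbergPollack2004, §§2–4] [cite: Moncrief1975, §III] -/
def ChruscielDelay_parametricAnnulusGluing : Prop :=
  ∀ (X : Type) [TopologicalSpace X] [ChartedSpace E3 X] [IsManifold (𝓡 3) ∞ X]
    [T2Space X] [SecondCountableTopology X] [ConnectedSpace X]
    (e : AFEnd X) (D : InitialDataSet (𝓡 3) X)
    (F : EuclideanSpace ℝ (Fin 1) → InitialDataSet (𝓡 3) X) (R₁ R₂ : ℝ),
    (∀ [D.metric.HasLeviCivita], D.IsVacuumConstraintSolution) →
    InitialDataSet.IsSmoothDataFamily 1 F → F 0 = D →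
    (∀ c, ∀ [(F c).metric.HasLeviCivita], (F c).IsVacuumConstraintSolution) →
    e.R ≤ R₁ → R₁ < R₂ →
    (¬ ∃ (N : E3 → ℝ) (Y : E3 → E3),
        ContDiffOn ℝ ∞ N {y : E3 | R₁ < ‖y‖ ∧ ‖y‖ < R₂} ∧
        ContDiffOn ℝ ∞ Y {y : E3 | R₁ < ‖y‖ ∧ ‖y‖ < R₂} ∧
        (∃ y : E3, R₁ < ‖y‖ ∧ ‖y‖ < R₂ ∧ (N y ≠ 0 ∨ Y y ≠ 0)) ∧
        ∀ y : E3, R₁ < ‖y‖ → ‖y‖ < R₂ →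
          MetricCoord.adjHamG (e.hCoeff D) (e.kCoeff D) N y
              + MetricCoord.adjMomGS (e.hCoeff D) (e.kCoeff D) Y y = 0 ∧
            MetricCoord.adjHamK (e.hCoeff D) (e.kCoeff D) N y
              + MetricCoord.adjMomKS (e.hCoeff D) Y y = 0) →
    ∃ (G : EuclideanSpace ℝ (Fin 1) → InitialDataSet (𝓡 3) X) (ε : ℝ), 0 < ε ∧
      InitialDataSet.IsSmoothDataFamily 1 G ∧ G 0 = D ∧
      (∀ c, ∀ [(G c).metric.HasLeviCivita], (G c).IsVacuumConstraintSolution) ∧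
      (∀ c, ‖c‖ < ε → ∀ x ∉ e.far R₁,
        (G c).h.inner x = (F c).h.inner x ∧ (G c).k x = (F c).k x) ∧
      (∀ c, ∀ x ∈ e.far R₂, (G c).h.inner x = D.h.inner x ∧ (G c).k x = D.k x)

end Literature.Geometry.Lorentzian

end
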